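import Summits.NavierStokesRegularity.NavierStokesRegularity.Theses.CoriolisHead
import Literature.Analysis.FluidPDE.TsaiSelfSimilarBounded
import HarnessLib

/-!
# Route CoriolisHead · crux `NoCoRotatingCore` (stmt-NavierStokesRegularity-22676) —
# RUNG: no co-rotating core for AXISYMMETRIC rotated profiles (equivariant about the frame axis)

Support file (`--supports stmt-NavierStokesRegularity-22676`; theorems only, no definitions, no named
facts): a second DECIDED SUB-CLASS (bc5 rung / T3 witness) of the open crux `NoCoRotatingCore`
(every smooth bounded solution of the rotated Leray profile system
`−νΔU + aU + a DU[y] + (BU − DU[By]) + DU[U] + ∇P = 0`, `div U = 0`, `ν, a > 0`, `B` skew, has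
`tr(B∘DU) = Σₗ (B ∂ₗU)ₗ ≥ 0` everywhere) — the judge's candidate shape (a) "NoCoRotatingCore restricted
to AXISYMMETRIC rotated profiles".

THE CLASS.  `U` is axisymmetric about the frame axis (swirl allowed) iff it is equivariant under the
rotations `e^{θB}` generated by the skew `B` (`Bx = β × x`): `U(e^{θB} y) = e^{θB} U(y)`; infinitesimally
(and equivalently, for smooth `U`) the Lie derivative along the rotation field vanishes,

  `DU(y)[By] = B U(y)`  for all `y`      (hypothesis `hequi`).

THE OBSERVATION (`isLerayProfile_of_rotated_of_equivariant`).  On this class the Coriolis term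
`BU − DU[By]` of the rotated system VANISHES IDENTICALLY, so `(U, P)` is an ordinary (non-rotating)
Leray profile `IsLerayProfile ν a U P`; by Tsai's theorem for bounded profiles (tree:
`IsLerayProfile.exists_eq_const_of_bounded`, Tsai 1998 Thm 1, `q = ∞`) it is CONSTANT
(`exists_eq_const_of_equivariant`), its gradient vanishes, and the crux's conclusion holds with
equality (`noCoRotatingCore_of_equivariant`, binders = those of the crux plus `hequi`).

HONEST FRAMING.  A decided special case, not the crux: `NoCoRotatingCore` (≡ bounded rotated-profile
Liouville, Pineau–Vicol Conj. 1.1 strengthened) stays OPEN, and Navier–Stokes regularity is NOT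
proved.  As a T3 witness this rung is THIN — axisymmetric Type-I blow-up is excluded in print
(Koch–Nadirashvili–Seregin–Šverák 2009) and the rotation is invisible on the class; it records that a
genuine rotated profile must break the frame's axial symmetry.  Companion rung (no axial velocity,
spin-vorticity mechanism): `CoriolisHeadNoCoRotatingCoreNoAxialVelocity`.

References: T.-P. Tsai, ARMA 143 (1998) 29–51, Thm 1 [Tsai1998]; B. Pineau, V. Vicol,
arXiv:2607.09619, (1.8), Conj. 1.1 [PineauVicol2026]; G. Koch, N. Nadirashvili, G. Seregin,
V. Šverák, Acta Math. 203 (2009) 83–105, Thm 1.2 [KNSS2009].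
-/

noncomputable section

-- the summit and its single sub-problem share the name (CONVENTIONS §1), as in every Theorems file
set_option linter.dupNamespace false

open scoped RealInnerProductSpace Laplacian ContDiff BigOperators
open Literature.Analysis.FluidPDE

namespace Summit.NavierStokesRegularity.NavierStokesRegularity.Theorems.CoriolisHead

section Equivariant

variable {ν a : ℝ} {B : EuclideanSpace ℝ (Fin 3) →L[ℝ] EuclideanSpace ℝ (Fin 3)}
  {U : EuclideanSpace ℝ (Fin 3) → EuclideanSpace ℝ (Fin 3)} {P : EuclideanSpace ℝ (Fin 3) → ℝ}

/-- **An axisymmetric rotated profile is a Leray profile.** If `U` is equivariant under the frame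
rotation (`DU(y)[By] = BU(y)`), the Coriolis term `BU − DU[By]` of the rotated profile system vanishes
and `(U, P)` solves Leray's system `−νΔU + aU + a DU[y] + DU[U] + ∇P = 0`, `div U = 0`.
[cite: PineauVicol2026, (1.8) (p. 3)] -/
theorem isLerayProfile_of_rotated_of_equivariant (hU : ContDiff ℝ (⊤ : ℕ∞) U) (hP : ContDiff ℝ 2 P)
    (hdiv : VectorCalculus.IsDivFree U)
    (heq : ∀ y, -(ν • Laplacian.laplacian U y) + a • U y + a • fderiv ℝ U y y
      + (B (U y) - fderiv ℝ U y (B y)) + convect U U y + gradient P y = 0)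
    (hequi : ∀ y, fderiv ℝ U y (B y) = B (U y)) : IsLerayProfile ν a U P where
  contDiff_velocity := hU.of_le (by norm_cast)
  contDiff_pressure := hP.of_le (by norm_num)
  profile_eq y := by
    have h := heq y
    rw [hequi y, sub_self, add_zero] at h
    exact h
  divFree := hdiv

/-- **Axisymmetric bounded rotated profiles are constant** (any `ν, a > 0`, any skew `B`): Tsai's
theorem for bounded Leray profiles applied to the class. [cite: Tsai1998, Thm 1 (q = ∞, p. 31)] -/
theorem exists_eq_const_of_equivariant (hν : 0 < ν) (ha : 0 < a) (hU : ContDiff ℝ (⊤ : ℕ∞) U)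
    (hP : ContDiff ℝ 2 P) (hdiv : VectorCalculus.IsDivFree U)
    (heq : ∀ y, -(ν • Laplacian.laplacian U y) + a • U y + a • fderiv ℝ U y y
      + (B (U y) - fderiv ℝ U y (B y)) + convect U U y + gradient P y = 0)
    (hbdd : ∃ M : ℝ, ∀ y, ‖U y‖ ≤ M) (hequi : ∀ y, fderiv ℝ U y (B y) = B (U y)) :
    ∃ b : EuclideanSpace ℝ (Fin 3), ∀ y, U y = b :=
  (isLerayProfile_of_rotated_of_equivariant hU hP hdiv heq hequi).exists_eq_const_of_bounded hν ha hbdd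

/-- On the axisymmetric class the velocity gradient vanishes identically. [cite: Tsai1998, Thm 1 (q = ∞, p. 31)] -/
theorem fderiv_eq_zero_of_equivariant (hν : 0 < ν) (ha : 0 < a) (hU : ContDiff ℝ (⊤ : ℕ∞) U)
    (hP : ContDiff ℝ 2 P) (hdiv : VectorCalculus.IsDivFree U)
    (heq : ∀ y, -(ν • Laplacian.laplacian U y) + a • U y + a • fderiv ℝ U y y
      + (B (U y) - fderiv ℝ U y (B y)) + convect U U y + gradient P y = 0)
    (hbdd : ∃ M : ℝ, ∀ y, ‖U y‖ ≤ M) (hequi : ∀ y, fderiv ℝ U y (B y) = B (U y))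
    (y : EuclideanSpace ℝ (Fin 3)) : fderiv ℝ U y = 0 := by
  obtain ⟨b, hb⟩ := exists_eq_const_of_equivariant hν ha hU hP hdiv heq hbdd hequi
  have hUc : U = fun _ => b := funext hb
  rw [hUc]
  exact fderiv_const_apply b

end Equivariant

/-! ### The rung, in the binders of the crux -/

/-- **RUNG of `NoCoRotatingCore` (bc5 witness): no co-rotating core for AXISYMMETRIC rotated profiles.**
The crux `CoriolisHead.NoCoRotatingCore` restricted to profiles equivariant under the frame rotation
(`DU(y)[By] = BU(y)`, i.e. axisymmetric about the axis of `B`, swirl allowed): for every `ν, a > 0`,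
skew `B`, and every smooth bounded divergence-free axisymmetric solution `(U, P)` of the rotated Leray
profile system, the Coriolis defect is signed — indeed zero — everywhere: `0 ≤ Σₗ (B ∂ₗU(y))ₗ`.
Same binders as the crux plus the one class hypothesis; the crux itself remains open.
[cite: Tsai1998, Thm 1 (q = ∞, p. 31)] -/
theorem noCoRotatingCore_of_equivariant : ∀ (ν a : ℝ), 0 < ν → 0 < a →
    ∀ (B : EuclideanSpace ℝ (Fin 3) →L[ℝ] EuclideanSpace ℝ (Fin 3))
      (U : EuclideanSpace ℝ (Fin 3) → EuclideanSpace ℝ (Fin 3)) (P : EuclideanSpace ℝ (Fin 3) → ℝ),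
      ContDiff ℝ (⊤ : ℕ∞) U → ContDiff ℝ 2 P → (∀ x, inner ℝ (B x) x = 0) →
      Literature.Analysis.FluidPDE.VectorCalculus.IsDivFree U →
      (∀ y, -(ν • Laplacian.laplacian U y) + a • U y + a • fderiv ℝ U y y + (B (U y) - fderiv ℝ U y (B y))
        + Literature.Analysis.FluidPDE.convect U U y + gradient P y = 0) →
      (∃ M : ℝ, ∀ y, ‖U y‖ ≤ M) →
      (∀ y, fderiv ℝ U y (B y) = B (U y)) →
      ∀ y, 0 ≤ ∑ l, (B (fderiv ℝ U y (EuclideanSpace.single l 1))) l := by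
  intro ν a hν ha B U P hU hP _hB hdiv heq hbdd hequi y
  simp [fderiv_eq_zero_of_equivariant hν ha hU hP hdiv heq hbdd hequi y]

end Summit.NavierStokesRegularity.NavierStokesRegularity.Theorems.CoriolisHead

end
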